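import Summits.BirchSwinnertonDyer.BirchSwinnertonDyer.Theorems.CMKolyvaginAtInertTwoLowerLevelTwoClosureAtTwo
import Summits.BirchSwinnertonDyer.BirchSwinnertonDyer.Theorems.CMKolyvaginAtInertTwoLowerStubLowerAtTwo
import HarnessLib

/-!
# Route `CMKolyvaginAtInertTwo`, crux `CMKolyvaginExactAtInertTwo` (stmt-BirchSwinnertonDyer-24277), `stub_lower` — W-UP on H₂,
# FILE W4d: `stub_lower`'S CONCLUSION FROM THE REGISTERED (SHALLOW) CERTIFICATE on H₂ ∩ {|d_K| prime}, modulo the four published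
# inputs and Gross 1991 Prop. 3.7 (2)

Seat `bsd-line-cmk2-p1` g19 (cell `bsd-print-cf2`), `--supports stmt-BirchSwinnertonDyer-24277` (helper; closes nothing by name).
THEOREMS ONLY (no definition, no named fact, no `sorry`).  BSD is NOT proved by any of this; the crux is not closed here.

WHAT.  File W4c's witness upgrade (`exists_deep_primitive_two_of_certificate`: the crux's own certificate `(n, d)` — square-free `n`
of Zhang–Kolyvagin primes at `2` that are CM-inert, `P(n) ∉ 2E(K[n])` — yields an ALL-DEEP primitive product) composed with McCallum's
Cor. 4.5 at `2` (gk2's single-datum conversions) gives a LEVEL-`4` GROSS WITNESS (`exists_grossWitness_of_certificate`); file D1's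
headline then gives `2^{2M₀} ≤ #Ш(E_K)(2)`:
* **`pow_le_card_primaryComponent_sha_two_baseChange_of_certificate_of_printedInputs`** — 24277's `≥` half from ITS OWN hypotheses plus
  `Nat.Prime |d_K|`, CONDITIONAL ONLY on `gross_zagier` (24148), `rank_eq_analyticRank_of_analyticRank_le_one` (19921),
  `hasEntireLFunction_rat` (19273), `Milne1972.bsdQuotient_baseChange_quadratic_anyModel` (24149) and the named fact
  `GrossLMS1991.prop37_2_reductionCongruence_inert N_E W K`;
* **`stub_lower_of_prime_of_printedInputs`** — the registered `stub_lower` signature VERBATIM followed by these extra hypotheses.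
Residuals (honest): composite `d_K` (Σ ≥ 2); the fact `prop37_2` (typer task); the four prints.  BSD is NOT proved by any of this.

References: [McCallumLMS1991] §4 Cor. 4.5, §5 Prop. 5.2, Thm. 5.4; [Kolyvagin1991MathAnn] Thm. 2.2; [GrossLMS1991] Prop. 3.7 (2);
[GrossZagier1986]; [Milne1972].
-/

set_option autoImplicit false
-- the Theorems namespace of this sub repeats the summit name by design (D-0017 nested layout)
set_option linter.dupNamespace false

noncomputable section

open scoped Classical

open WeierstrassCurve NumberField IsDedekindDomain Field Literature.NumberTheory.EllipticCurves
open Literature.NumberTheory.EllipticCurves.ModularForms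
open Literature.NumberTheory.EllipticCurves.GrossLMS1991 (prop37_2_reductionCongruence_inert)
open Summit.BirchSwinnertonDyer.BirchSwinnertonDyer.Theorems.GenusExact
open Summit.BirchSwinnertonDyer.Rank1Residual

namespace Summit.BirchSwinnertonDyer.BirchSwinnertonDyer.Theorems.KolyvaginLowerTwo

/-- **THE LEVEL-4 GROSS WITNESS FROM THE CRUX'S CERTIFICATE (H₂, prime `|d_K|`), modulo Gross 1991 Prop. 3.7 (2).**  From a square-free
`n` of Zhang–Kolyvagin primes at `2` that are CM-inert and a datum `d` with `P(n) ∉ 2E(K[n])`: a square-free `n₀` all of whose primes are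
Zhang–Kolyvagin of index `≥ 2` with `Frob = Frob_∞` on `K(E[4])`, and a datum `e₀` with `addOrderOf c₂(e₀) = 4`.  (File W4c + McCallum
Cor. 4.5 at `2`: `not_two_dvd_derivedPoint_of_addOrderOf_kolyvaginClass_two_pow`, `addOrderOf_kolyvaginClass_two_eq_pow_of_not_two_dvd_single`.)
[cite: McCallumLMS1991, §4 Cor. 4.5 and §5 proof of Prop. 5.2] [cite: GrossLMS1991, Prop. 3.7 (2)] -/
theorem exists_grossWitness_of_certificate (W : WeierstrassCurve ℚ) [W.IsElliptic] [W.IsGloballyMinimal]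
    [NeZero (W.conductorNorm ℤ)] (hCM : W.HasCM) (hin : Rank1Residual.CMInert W 2) (hρ2 : W.HasSurjectiveModNGaloisRep 2)
    (hT : Odd W.tamagawaProduct) {K : Type} [Field K] [NumberField K] (hK : IsImaginaryQuadratic K)
    (hodd : Odd (NumberField.discr K)) (h3 : NumberField.discr K ≠ -3) (hq : (NumberField.discr K).natAbs.Prime)
    (hHe : SatisfiesHeegnerHypothesis (W.conductorNorm ℤ) K) (h37 : prop37_2_reductionCongruence_inert (W.conductorNorm ℤ) W K)
    (Dt : ModularParametrizationData W (W.conductorNorm ℤ)) (β : ℤ) (ι : K →+* ℂ)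
    {n : ℕ} (d : KolyvaginHeegnerData Dt β ι n) (hn : Squarefree n)
    (hKoly : ∀ ℓ ∈ n.primeFactors, Zhang2014.IsKolyvaginPrime (W.conductorNorm ℤ) W K 2 ℓ ∧ Rank1Residual.CMInert W ℓ)
    (hPn : ¬ ∃ Q : (W.baseChange (ringClassField K ι n)).toAffine.Point, (2 : ℤ) • Q = d.derivedPoint) :
    ∃ (n₀ : ℕ) (e₀ : KolyvaginHeegnerData Dt β ι n₀), Squarefree n₀ ∧
      (∀ q ∈ n₀.primeFactors, Zhang2014.IsKolyvaginPrime (W.conductorNorm ℤ) W K 2 q ∧ 2 ≤ Zhang2014.kolyvaginIndex W 2 q ∧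
        FrobEqFrobInfty W K (2 ^ 2) q) ∧
      addOrderOf (e₀.kolyvaginClass Nat.prime_two 2) = 2 ^ 2 := by
  haveI : ∀ j : ℕ, NumberField (ringClassField K ι j) := JET.numberField_ringClassField K hK ι
  obtain ⟨n₀, e₀, hn₀, hn₀K, he₁⟩ := exists_deep_primitive_two_of_certificate W hCM hin hρ2 hT hK hodd h3 hq hHe h37 Dt β ι d hn
    hKoly hPn
  have hn₀K1 : ∀ q ∈ n₀.primeFactors, Zhang2014.IsKolyvaginPrime (W.conductorNorm ℤ) W K 2 q ∧ 1 ≤ Zhang2014.kolyvaginIndex W 2 q :=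
    fun q hq ↦ ⟨(hn₀K q hq).1, le_trans (by norm_num) (hn₀K q hq).2.1⟩
  have hn₀K2 : ∀ q ∈ n₀.primeFactors, Zhang2014.IsKolyvaginPrime (W.conductorNorm ℤ) W K 2 q ∧ 2 ≤ Zhang2014.kolyvaginIndex W 2 q :=
    fun q hq ↦ ⟨(hn₀K q hq).1, (hn₀K q hq).2.1⟩
  have hprim := RelaxedCount.not_two_dvd_derivedPoint_of_addOrderOf_kolyvaginClass_two_pow W hK hodd h3 hHe hρ2 Dt β ι (L := 1)
    le_rfl hn₀ hn₀K1 e₀ he₁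
  exact ⟨n₀, e₀, hn₀, hn₀K, RelaxedCount.addOrderOf_kolyvaginClass_two_eq_pow_of_not_two_dvd_single W hK hodd h3 hHe hρ2 Dt β ι
    (M := 2) (by norm_num) hn₀ hn₀K2 e₀ hprim⟩

/-- **`stub_lower`'S CONCLUSION FROM THE REGISTERED CERTIFICATE on H₂ ∩ {|d_K| prime}, modulo the four prints + Gross 3.7 (2).**
24277's frame, `M₀`-clause and certificate `(n, d)` verbatim, plus `Nat.Prime |d_K|`, the four published inputs and
`prop37_2_reductionCongruence_inert N_E W K`: **`2^(2·M₀) ≤ Nat.card (Ш(E_K)(2))`**.  (`exists_grossWitness_of_certificate` + file D1's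
`pow_le_card_primaryComponent_sha_two_baseChange_of_grossWitness_of_printedInputs`.)  BSD is NOT proved by this.
[cite: McCallumLMS1991, §5 Prop. 5.2 and Thm. 5.4] [cite: Kolyvagin1991MathAnn, Thm. 2.2] [cite: GrossLMS1991, Prop. 3.7 (2)] -/
theorem pow_le_card_primaryComponent_sha_two_baseChange_of_certificate_of_printedInputs
    (hGZ : ∀ (N : ℕ) [NeZero N] (W : WeierstrassCurve ℚ) (K : Type) [Field K] [NumberField K], gross_zagier N W K)
    (hGZK : rank_eq_analyticRank_of_analyticRank_le_one) (hmod : hasEntireLFunction_rat)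
    (hMilneC : Milne1972.bsdQuotient_baseChange_quadratic_anyModel)
    (W : WeierstrassCurve ℚ) [W.IsElliptic] [W.IsGloballyMinimal] [NeZero (W.conductorNorm ℤ)]
    (hCM : W.HasCM) (hin : Rank1Residual.CMInert W 2) (hρ2 : W.HasSurjectiveModNGaloisRep 2)
    (hT : Odd W.tamagawaProduct) (K : Type) [Field K] [NumberField K] (hIQ : IsImaginaryQuadratic K)
    (hodd : Odd (NumberField.discr K)) (h3 : NumberField.discr K ≠ -3) (hq : (NumberField.discr K).natAbs.Prime)
    (hHe : SatisfiesHeegnerHypothesis (W.conductorNorm ℤ) K)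
    (h37 : prop37_2_reductionCongruence_inert (W.conductorNorm ℤ) W K)
    (Dt : ModularParametrizationData W (W.conductorNorm ℤ)) (β : ℤ) (ι : K →+* ℂ) (d₁ : KolyvaginHeegnerData Dt β ι 1)
    (hy : ¬ IsOfFinAddOrder d₁.derivedPoint) (M₀ : ℕ)
    (hM₀ : ∃ Q : (W.baseChange (ringClassField K ι 1)).toAffine.Point, ((2 ^ M₀ : ℕ) : ℤ) • Q = d₁.derivedPoint)
    (hndiv : ¬ ∃ Q : (W.baseChange (ringClassField K ι 1)).toAffine.Point, ((2 ^ (M₀ + 1) : ℕ) : ℤ) • Q = d₁.derivedPoint)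
    {n : ℕ} (d : KolyvaginHeegnerData Dt β ι n) (hn : Squarefree n)
    (hKoly : ∀ ℓ ∈ n.primeFactors, Zhang2014.IsKolyvaginPrime (W.conductorNorm ℤ) W K 2 ℓ ∧ Rank1Residual.CMInert W ℓ)
    (hPn : ¬ ∃ Q : (W.baseChange (ringClassField K ι n)).toAffine.Point, (2 : ℤ) • Q = d.derivedPoint) :
    2 ^ (2 * M₀) ≤ Nat.card (AddCommGroup.primaryComponent (W.baseChange K).sha 2) := by
  obtain ⟨n₀, e₀, hn₀, hn₀K, he₀⟩ := exists_grossWitness_of_certificate W hCM hin hρ2 hT hIQ hodd h3 hq hHe h37 Dt β ι d hn hKoly hPn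
  exact pow_le_card_primaryComponent_sha_two_baseChange_of_grossWitness_of_printedInputs hGZ hGZK hmod hMilneC W hCM hin hρ2 hT K hIQ
    hodd h3 hq hHe h37 Dt β ι d₁ hy M₀ hM₀ hndiv hn₀ hn₀K e₀ he₀

/-- **The registered `stub_lower` signature VERBATIM, followed by the extra hypotheses `Nat.Prime |d_K|`, Gross 3.7 (2) by name and
the four published inputs** — what this seat can honestly close for crux 24277's `≥` half (the two `¬ IsSquare` clauses of the crux are
unused).  BSD is NOT proved by this; nothing is closed by name. [cite: McCallumLMS1991, §5 Thm. 5.4] [cite: GrossLMS1991, Prop. 3.7 (2)] -/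
theorem stub_lower_of_prime_of_printedInputs :
    ∀ (W : WeierstrassCurve ℚ) [W.IsElliptic] [W.IsGloballyMinimal] [NeZero (W.conductorNorm ℤ)], W.HasCM → Literature.NumberTheory.EllipticCurves.Rank1Residual.CMInert W 2 → W.HasSurjectiveModNGaloisRep (2 : ℤ) → Odd W.tamagawaProduct → ∀ (K : Type) [Field K] [NumberField K], Literature.NumberTheory.EllipticCurves.IsImaginaryQuadratic K → Odd (NumberField.discr K) → NumberField.discr K ≠ -3 → Literature.NumberTheory.EllipticCurves.SatisfiesHeegnerHypothesis (W.conductorNorm ℤ) K → ¬ IsSquare ((NumberField.discr K : ℚ) * -|W.Δ|) → ¬ IsSquare ((NumberField.discr K : ℚ) * (-(2 * |W.Δ|))) → ∀ (Dt : Literature.NumberTheory.EllipticCurves.ModularForms.ModularParametrizationData W (W.conductorNorm ℤ)) (β : ℤ) (ι : K →+* ℂ) (d₁ : Literature.NumberTheory.EllipticCurves.KolyvaginHeegnerData Dt β ι 1), ¬ IsOfFinAddOrder d₁.derivedPoint → ∀ (M₀ : ℕ), (∃ Q : (W.baseChange (Literature.NumberTheory.EllipticCurves.ringClassField K ι 1)).toAffine.Point,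 ((2 ^ M₀ : ℕ) : ℤ) • Q = d₁.derivedPoint) → (¬ ∃ Q : (W.baseChange (Literature.NumberTheory.EllipticCurves.ringClassField K ι 1)).toAffine.Point, ((2 ^ (M₀ + 1) : ℕ) : ℤ) • Q = d₁.derivedPoint) → ∀ (n : ℕ) (d : Literature.NumberTheory.EllipticCurves.KolyvaginHeegnerData Dt β ι n), Squarefree n → (∀ ℓ ∈ n.primeFactors, (Literature.NumberTheory.EllipticCurves.Zhang2014.IsKolyvaginPrime (W.conductorNorm ℤ) W K 2 ℓ ∧ Literature.NumberTheory.EllipticCurves.Rank1Residual.CMInert W ℓ)) → (¬ ∃ Q : (W.baseChange (Literature.NumberTheory.EllipticCurves.ringClassField K ι n)).toAffine.Point, (2 : ℤ) • Q = d.derivedPoint) →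
      -- the extra hypotheses
      Nat.Prime (NumberField.discr K).natAbs →
      Literature.NumberTheory.EllipticCurves.GrossLMS1991.prop37_2_reductionCongruence_inert (W.conductorNorm ℤ) W K →
      (∀ (N : ℕ) [NeZero N] (W : WeierstrassCurve ℚ) (K : Type) [Field K] [NumberField K], gross_zagier N W K) →
      rank_eq_analyticRank_of_analyticRank_le_one → hasEntireLFunction_rat → Milne1972.bsdQuotient_baseChange_quadratic_anyModel →
      2 ^ (2 * M₀) ≤ Nat.card (AddCommGroup.primaryComponent (W.baseChange K).sha 2) := by
  intro W _ _ _ hCM hin hρ hT K _ _ hK hodd h3 hH _ _ Dt β ι d₁ hy M₀ hdiv hndiv n d hn hKoly hPn hq h37 hGZ hGZK hmod hMi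
  exact pow_le_card_primaryComponent_sha_two_baseChange_of_certificate_of_printedInputs hGZ hGZK hmod hMi W hCM hin hρ hT K hK hodd h3
    hq hH h37 Dt β ι d₁ hy M₀ hdiv hndiv d hn hKoly hPn

end Summit.BirchSwinnertonDyer.BirchSwinnertonDyer.Theorems.KolyvaginLowerTwo

end
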